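import Summits.QuantumFields.YangMills.Statement

/-!
# `YangMills` — negative lemma: the linearity conjunct of `IsCompactSimpleLieGroup` is load-bearing

Refuter crux-attack on item stmt-QuantumFields-14093 (`HeavyThresholdYMBridge.YangMills :=
_root_.YangMills`, the registered condition of the conditional bridge, = the summit conjunct
verbatim). The crux survives every cheap attack (it is the Clay problem); this file records the one
hypothesis-mutation finding as a kernel-checked fact.

`IsCompactSimpleLieGroup G := IsSimpleCompactGroup G ∧ Nonempty (LatticeRep G)`. Deleting the second
conjunct makes the statement JUNK-FALSE: every non-abelian group carrying the INDISCRETE topology is a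
compact connected topological group that passes `IsSimpleCompactGroup` vacuously (its only closed
subgroup is `⊤`, because `⊥` is not closed), yet it admits no faithful continuous matrix
representation (that would force Hausdorff), so the conclusion `∃ r : LatticeRep G, …` fails.
Witness: `DihedralGroup 3`.

* `isSimpleCompactGroup_indiscrete` — under `⊤` every non-abelian group passes `IsSimpleCompactGroup`;
* `yangMills_false_without_linear` — `¬ (_root_.YangMills with the hypothesis weakened to
  IsSimpleCompactGroup G)` (stated inline; no new `def : Prop`).

So any proof of `YangMills` uses `Nonempty (LatticeRep G)` — if only to exclude non-Hausdorff junk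
(for Hausdorff compact groups `IsSimpleCompactGroup` already forces a compact simple Lie group by the
structure theory of compact groups, on paper; not in the tree).
-/

open Literature.MathematicalPhysics.QuantumFieldTheory Literature.MathematicalPhysics.QuantumLattice

namespace Summit.QuantumFields.QCD.Theorems.YangMills.Negative

/-- **Under the indiscrete topology every non-abelian group passes `IsSimpleCompactGroup`**:
it is connected (the only open sets are `∅`, `univ`), non-abelian by hypothesis, and a closed
subgroup is all of `G` (`⊥ ∋ 1` is not closed unless `G` is trivial). -/
theorem isSimpleCompactGroup_indiscrete (G : Type) [Group G] (h : ∃ a b : G, a * b ≠ b * a) :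
    @IsSimpleCompactGroup G _ ⊤ := by
  letI : TopologicalSpace G := ⊤
  have hopen : ∀ U : Set G, IsOpen U → U = ∅ ∨ U = Set.univ := fun U hU =>
    (TopologicalSpace.isOpen_top_iff U).1 hU
  haveI : PreconnectedSpace G := ⟨by
    intro u v hu hv _ hxu hyv
    obtain ⟨x, -, hxu⟩ := hxu
    obtain ⟨y, -, hyv⟩ := hyv
    rcases hopen u hu with rfl | rfl
    · simp at hxu
    rcases hopen v hv with rfl | rfl
    · simp at hyv
    exact ⟨x, Set.mem_univ _, Set.mem_univ _, Set.mem_univ _⟩⟩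
  haveI : ConnectedSpace G := ⟨⟨1⟩⟩
  refine ⟨‹_›, h, fun N _ hN _ => ?_⟩
  rcases hopen _ (isOpen_compl_iff.2 hN) with hc | hc
  · right
    rw [Set.compl_empty_iff] at hc
    exact Subgroup.coe_eq_univ.1 hc
  · exfalso
    have h1 : (1 : G) ∈ (N : Set G)ᶜ := hc ▸ Set.mem_univ _
    exact h1 N.one_mem

/-- **The linearity conjunct is load-bearing**: `_root_.YangMills` with its hypothesis weakened
from `IsCompactSimpleLieGroup G` (`= IsSimpleCompactGroup G ∧ Nonempty (LatticeRep G)`) to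
`IsSimpleCompactGroup G` alone — conclusion verbatim that of the summit conjunct — is FALSE. Witness
`G = DihedralGroup 3` with the indiscrete topology `⊤` (a compact connected topological group,
`IsSimpleCompactGroup` by `isSimpleCompactGroup_indiscrete`); a `LatticeRep G` would make `G`
Hausdorff (`T2Space.of_injective_continuous`), hence `{1}` closed, hence `{1} = univ` or
`{1}ᶜ = univ` in the indiscrete topology — both absurd. -/
theorem yangMills_false_without_linear :
    ¬ ∀ (G : Type) [Group G] [TopologicalSpace G] [IsTopologicalGroup G] [CompactSpace G],
        IsSimpleCompactGroup G →
          letI : MeasurableSpace G := borel G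
          haveI : BorelSpace G := ⟨rfl⟩
          ∃ (r : LatticeRep G) (sch : SpeciesScheme (YMSpecies G)) (T : OSData (YMSpecies G) 4),
            IsYangMillsFor r sch T ∧ T.IsNontrivial r.curvature ∧ T.IsNonGaussian r.curvature ∧
              ∃ Δ > 0, T.HasMassGap Δ ∧ HasLatticeMassGap r sch Δ := by
  intro h
  letI : TopologicalSpace (DihedralGroup 3) := ⊤
  haveI : IsTopologicalGroup (DihedralGroup 3) :=
    { continuous_mul := continuous_top, continuous_inv := continuous_top }
  have hna : ∃ a b : DihedralGroup 3, a * b ≠ b * a :=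
    ⟨DihedralGroup.r 1, DihedralGroup.sr 0, by decide⟩
  obtain ⟨r, -⟩ := h (DihedralGroup 3) (isSimpleCompactGroup_indiscrete _ hna)
  haveI : T2Space (DihedralGroup 3) := .of_injective_continuous r.injective r.continuous
  have hcl : IsClosed ({1} : Set (DihedralGroup 3)) := isClosed_singleton
  rcases (TopologicalSpace.isOpen_top_iff _).1 (isOpen_compl_iff.2 hcl) with hc | hc
  · rw [Set.compl_empty_iff] at hc
    have : (DihedralGroup.sr 0 : DihedralGroup 3) ∈ ({1} : Set (DihedralGroup 3)) :=
      hc ▸ Set.mem_univ _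
    exact absurd (Set.mem_singleton_iff.1 this) (by decide)
  · have : (1 : DihedralGroup 3) ∈ ({1} : Set (DihedralGroup 3))ᶜ := hc ▸ Set.mem_univ _
    exact this rfl

end Summit.QuantumFields.QCD.Theorems.YangMills.Negative
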